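import Summits.KontsevichZagierPeriods.KontsevichZagierPeriods.Theses.HurwitzMicroSectors
import Summits.KontsevichZagierPeriods.KontsevichZagierPeriods.Theorems.HurwitzMicroSectorsNormalFormPrinciplePiBoxTransfer
import Summits.KontsevichZagierPeriods.KontsevichZagierPeriods.Theorems.HurwitzMicroSectorsNormalFormPrincipleVariants2227

/-! TTRL-lite variant V2257 of stmt-KontsevichZagierPeriods-3869

Variant V2257 = `stub_boxRigidity` (the leaf `BoxRigidity` of `NormalFormPrinciple`: two representations
on open unit boxes with integrands of KZ's rational shape `p/q` over `ℚ` and equal values are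
KZ-equivalent) under the TWO-sided move `fix_nat:m=3; fix_nat:m'=6` (left dimension frozen to `3`, right
dimension to `6`). Verdict of the attempt seat: **open** — this file is the exact-strength certificate,
not a proof of the variant. For every `K` let `BoxVanishing K` say that a box-rational representation of
dimension `K` and value `0` is a relation. A pair of FROZEN dimensions `(K, k)` is exactly
`BoxVanishing (max K k)` (`boxRigidityPair_iff_boxVanishingDim_right`, file `…Variants2227`: compare with
the zero representation on the `3`-box one way; pad both representations to the `6`-box, `pad_le`, and
subtract there, `sub_same`, the other way — the `3` is idle). Hence

* `stub_boxRigidity_var2257_iff_boxVanishing_six`: V2257 ⟺ **BoxVanishing 6**;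
* `stub_boxRigidity_var2257_iff_var2227` / `stub_boxRigidity_var2257_iff_swap`: V2257 is literally the
  sibling V2227 (`(m, m') = (2, 6)`) and the swapped pair `(6, 3)`;
* `stub_boxRigidity_var2257_iff_le_six`: V2257 ⟺ BoxRigidity for ALL `m, m' ≤ 6` — Conjecture 1 of
  Kontsevich–Zagier for every pair of rational integrands on the boxes `(0,1)^{≤6}`;
* `boxVanishing_le_six_of_stub_boxRigidity_var2257`: V2257 gives `BoxVanishing j` for every `j ≤ 6`, so
  it contains the square (`BoxVanishing 2`: for `a b : ℚ`, "`a + b·G = 0 ⇒ [a + b/(1+x²y²)]_{(0,1)²}` is a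
  relation", `G` Catalan's constant — provable today only through the irrationality of `G` (open) or an
  explicit chain of moves, none of which can exist unless `G ∈ ℚ`) and dimension `5` (the same dichotomy
  for `ζ(5) = ∫_{(0,1)⁵} dx/(1 − x₁⋯x₅)`). This is the residual goal; `BoxVanishing 1` is the tree's
  theorem `boxRigidity_of_le_one` (Baker), dimension `2` is the first open rung and V2257 sits four rungs
  above it;
* `stub_boxRigidity_var2257_of_parent` / `_of_statement`: parent leaf ⇒ V2257 and
  `KontsevichZagierPeriods ⇒ V2257`, so a refutation of the variant would refute Conjecture 1 for the
  tree's calculus — the variant is neither provable nor refutable from the tree today.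

Source: M. Kontsevich, D. Zagier, *Periods* (2001), §1.2 Conjecture 1. Pure proof file, no definitions. -/

-- `Summit.<Summit>.<Problem>` is the tree's mandated summit-side namespace (CONVENTIONS §2); for this
-- single-conjunct summit the two coincide, so the duplicate is deliberate.
set_option linter.dupNamespace false

noncomputable section

namespace Summit.KontsevichZagierPeriods.KontsevichZagierPeriods.Theorems

open MeasureTheory Set
open Literature.NumberTheory.Transcendental Literature.NumberTheory.Transcendental.KZ
open Summit.KontsevichZagierPeriods.KontsevichZagierPeriods.Theses.HurwitzMicroSectors
open Summit.KontsevichZagierPeriods.HurwitzMicroSectors.NormalFormPrinciple.PiBox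

/-! ## The variant V2257 itself: exactly `BoxVanishing 6` -/

/-- **V2257 ⟺ `BoxVanishing 6`** (instance `K = 3 ≤ 6 = k` of
`boxRigidityPair_iff_boxVanishingDim_right`: every box-rational representation on `(0,1)⁶` of value `0`
is a relation). [cite: KontsevichZagier2001, §1.2 Conjecture 1] -/
theorem stub_boxRigidity_var2257_iff_boxVanishing_six :
    (∀ (N : IntegralRep 3) (N' : IntegralRep 6), N.domain = {x | ∀ i, x i ∈ Set.Ioo (0:ℝ) 1} → N.IsRational → N'.domain = {x | ∀ i, x i ∈ Set.Ioo (0:ℝ) 1} → N'.IsRational → N.value = N'.value → Equivalent N N') ↔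
    (∀ (M : IntegralRep 6), M.domain = {x | ∀ i, x i ∈ Set.Ioo (0:ℝ) 1} → M.IsRational →
      M.value = 0 → of M ∈ relations) :=
  boxRigidityPair_iff_boxVanishingDim_right (by norm_num)

/-- **V2257 ⟺ the sibling V2227** (`fix_nat:m=2; fix_nat:m'=6`): both are `BoxVanishing 6`, the frozen
left dimension is idle. [cite: KontsevichZagier2001, §1.2 Conjecture 1] -/
theorem stub_boxRigidity_var2257_iff_var2227 :
    (∀ (N : IntegralRep 3) (N' : IntegralRep 6), N.domain = {x | ∀ i, x i ∈ Set.Ioo (0:ℝ) 1} → N.IsRational → N'.domain = {x | ∀ i, x i ∈ Set.Ioo (0:ℝ) 1} → N'.IsRational → N.value = N'.value → Equivalent N N') ↔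
    (∀ (N : IntegralRep 2) (N' : IntegralRep 6), N.domain = {x | ∀ i, x i ∈ Set.Ioo (0:ℝ) 1} → N.IsRational → N'.domain = {x | ∀ i, x i ∈ Set.Ioo (0:ℝ) 1} → N'.IsRational → N.value = N'.value → Equivalent N N') := by
  rw [stub_boxRigidity_var2257_iff_boxVanishing_six, stub_boxRigidity_var2227_iff_boxVanishing_six]

/-- **V2257 ⟺ the swapped pair `(6, 3)`** (symmetry of `Equivalent`: relations form a subgroup).
[cite: KontsevichZagier2001, §1.2 Conjecture 1] -/
theorem stub_boxRigidity_var2257_iff_swap :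
    (∀ (N : IntegralRep 3) (N' : IntegralRep 6), N.domain = {x | ∀ i, x i ∈ Set.Ioo (0:ℝ) 1} → N.IsRational → N'.domain = {x | ∀ i, x i ∈ Set.Ioo (0:ℝ) 1} → N'.IsRational → N.value = N'.value → Equivalent N N') ↔
    (∀ (N : IntegralRep 6) (N' : IntegralRep 3), N.domain = {x | ∀ i, x i ∈ Set.Ioo (0:ℝ) 1} → N.IsRational → N'.domain = {x | ∀ i, x i ∈ Set.Ioo (0:ℝ) 1} → N'.IsRational → N.value = N'.value → Equivalent N N') :=
  boxRigidityPair_comm 3 6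

/-- **V2257 ⟺ `BoxRigidity` for all `m, m' ≤ 6`** (the honest strength of the variant: Conjecture 1 for
all pairs of rational integrands on the open unit boxes of dimension at most `6`; so V2257 coincides with
the two-sided variants `bound_nat:m≤6; bound_nat:m'≤6` and `fix_nat:m=j; fix_nat:m'=k` for every
`max j k = 6`). [cite: KontsevichZagier2001, §1.2 Conjecture 1] -/
theorem stub_boxRigidity_var2257_iff_le_six :
    (∀ (N : IntegralRep 3) (N' : IntegralRep 6), N.domain = {x | ∀ i, x i ∈ Set.Ioo (0:ℝ) 1} → N.IsRational → N'.domain = {x | ∀ i, x i ∈ Set.Ioo (0:ℝ) 1} → N'.IsRational → N.value = N'.value → Equivalent N N') ↔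
    (∀ (m m' : ℕ) (N : IntegralRep m) (N' : IntegralRep m'), m ≤ 6 → m' ≤ 6 →
      N.domain = {x | ∀ i, x i ∈ Set.Ioo (0:ℝ) 1} → N.IsRational →
      N'.domain = {x | ∀ i, x i ∈ Set.Ioo (0:ℝ) 1} → N'.IsRational →
      N.value = N'.value → Equivalent N N') := by
  rw [stub_boxRigidity_var2257_iff_var2227]
  exact stub_boxRigidity_var2227_iff_le_six

/-- **V2257 ⇒ `BoxVanishing` in every dimension `≤ 6`** (monotonicity by padding), in particular the
square, which contains Catalan's dichotomy, and dimension `5`, which contains `ζ(5)`'s.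
[cite: KontsevichZagier2001, §1.2 Conjecture 1] -/
theorem boxVanishing_le_six_of_stub_boxRigidity_var2257
    (h : ∀ (N : IntegralRep 3) (N' : IntegralRep 6), N.domain = {x | ∀ i, x i ∈ Set.Ioo (0:ℝ) 1} → N.IsRational → N'.domain = {x | ∀ i, x i ∈ Set.Ioo (0:ℝ) 1} → N'.IsRational → N.value = N'.value → Equivalent N N')
    {j : ℕ} (hj : j ≤ 6) (N : IntegralRep j) (hNd : N.domain = {x | ∀ i, x i ∈ Set.Ioo (0:ℝ) 1})
    (hNr : N.IsRational) (hv : N.value = 0) : of N ∈ relations :=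
  boxVanishingDim_mono hj (stub_boxRigidity_var2257_iff_boxVanishing_six.1 h) N hNd hNr hv

/-! ## V2257 follows from the parent leaf and from the Summit -/

/-- **The parent leaf ⇒ V2257** (specialisation `m := 3`, `m' := 6`; the converse is not claimed — the
parent is `BoxVanishing` in ALL dimensions). [cite: KontsevichZagier2001, §1.2 Conjecture 1] -/
theorem stub_boxRigidity_var2257_of_parent
    (h : ∀ (m m' : ℕ) (N : IntegralRep m) (N' : IntegralRep m'), N.domain = {x | ∀ i, x i ∈ Set.Ioo (0:ℝ) 1} → N.IsRational → N'.domain = {x | ∀ i, x i ∈ Set.Ioo (0:ℝ) 1} → N'.IsRational → N.value = N'.value → Equivalent N N') :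
    ∀ (N : IntegralRep 3) (N' : IntegralRep 6), N.domain = {x | ∀ i, x i ∈ Set.Ioo (0:ℝ) 1} → N.IsRational → N'.domain = {x | ∀ i, x i ∈ Set.Ioo (0:ℝ) 1} → N'.IsRational → N.value = N'.value → Equivalent N N' :=
  h 3 6

/-- **`KontsevichZagierPeriods ⇒ V2257`**: the variant is a special case of Conjecture 1 for the tree's
calculus (`leaves_of_statement`) — so a refutation of the variant would refute the Summit.
[cite: KontsevichZagier2001, §1.2 Conjecture 1] -/
theorem stub_boxRigidity_var2257_of_statement (h : _root_.KontsevichZagierPeriods) :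
    ∀ (N : IntegralRep 3) (N' : IntegralRep 6), N.domain = {x | ∀ i, x i ∈ Set.Ioo (0:ℝ) 1} → N.IsRational → N'.domain = {x | ∀ i, x i ∈ Set.Ioo (0:ℝ) 1} → N'.IsRational → N.value = N'.value → Equivalent N N' :=
  stub_boxRigidity_var2257_of_parent (leaves_of_statement h).1

end Summit.KontsevichZagierPeriods.KontsevichZagierPeriods.Theorems

end
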